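import Literature.MathematicalPhysics.QuantumFieldTheory.Balaban1983to89.Beta.OneStepResolventKernel
import Literature.MathematicalPhysics.QuantumFieldTheory.Balaban1983to89.B6QGQFourier275Zd

/-!
# `BalabanUV.Beta.GAN24.CombesThomasFibre` — binder row G-an2-4 / (CONV-C), propagator slot, road P1: the packed one-step resolvent
# `KInv N` IS, ENTRY BY ENTRY, THE REAL PART OF THE LATTICE KERNEL OF THE INVERSE BLOCH FIBRE MATRIX; hence every SUP-NORM statement
# about it (census input (I2) of `GAN24/CombesThomas`) is a statement about explicit finite matrices `p ↦ F_N(p)⁻¹` on the real zone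

NOT IN PRINT; OUR PROOF ATTEMPT.  HONEST FRAMING (cell contract, verbatim): «discharging `BetaPertH` makes Bałaban's UV stability
UNCONDITIONAL — a real constructive-QFT result; it is NOT the continuum limit and NOT the Clay problem.»  HONEST DEPENDENCY (verbatim):
«continuum YM on T⁴ ⇐ BetaPertH ∧ nine spine estimates (0/9 proved); BetaPertH ⇐ (D1) ∧ (D4) ∧ CAP+tail; G-an2-4 gates asym, D1 and
NE2/3/4.»  This module is [folklore] BOOKKEEPING over the cell's own typed objects (an2's `KKTFluctuationKernel` / `KernelSpecInstance` /
`OneStepResolventKernel`, lit2's `FibreInverseDecay`, pv23's `B4ContourShift.latticeKernel`): definitional unfolding, the triangle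
inequality for integrals, `|Re z| ≤ ‖z‖`.  It cites nothing, mints no fact, instantiates no wall binder.  NOT summit progress.

## Why (road P1 of G-an2-4, `GAN24/CombesThomas` census (I2))

`GAN24/CombesThomas.decayCauchy_of_uniformDecays_supRate` reduced the wall's rate binder `hKall` to a ONE-STEP SUP-NORM rate of the
unit-normalised step resolvents `D_j · KInvStep Lc j · D_j`.  `KInvStep Lc j = dec (Lc^j) (KInv (Lc^(j+1)))` is a finite weighted sum of
entries of the packed resolvent `KInv`, and — THIS FILE — every entry of `KInv N` is the real part of a lattice Fourier coefficient
`(2π)^{−(d+1)} ∫_{[−π,π]^{d+1}} (F_N(p)⁻¹)_{ij} e^{ip·x} dp` of ONE entry of the inverse of the Bloch fibre matrix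
`F_N(p) = fibreMatrix (blochChar p) = trigPolySymbol (stencil (d+1)) pieceMatrix p` of the typed KKT block system (`BlochFibreMatrix`), at the
block offset `x = quo N x − quo N y`; so `|KInv N x y a b| ≤ sup_{p ∈ zone} ‖(F_N(p)⁻¹)_{ij}‖` (§3), and every sup-norm comparison of two such
kernels is a comparison of finite matrices on the real zone — the arena of the fibre algebra (pivot / effective form / Woodbury deviations,
row G-an2-4 road P3) and of the symbol estimates of King's Lemma 4.3 type.  No strip, no analyticity and no decay is used or needed here.

## Contents (all [folklore]; `N ≥ 1` the block side, lattice `ℤ^{d+1}`)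
§1 `fibInv N i j : (ℂ^{d+1} → ℂ) := p ↦ (trigPolySymbol (stencil (d+1)) pieceMatrix p)⁻¹ i j` (the inverse-fibre ENTRY FUNCTION; equals
   `((fibreMatrix (blochChar p))⁻¹) i j` at real `p`, `BlochFibreMatrix.fibreMatrix_blochChar_eq_trigPolySymbol`); `fundCfg_srcEL_apply`,
   `fundCfg_src_apply` (the fundamental configuration with a unit EL- / Q-source reads ONE column of the inverse kernel).
§2 THE FOUR BLOCKS: `Gam_eq_re_latticeKernel`, `wH_eq_re_latticeKernel`, `GamΦ_eq_re_latticeKernel`, `wΦ_eq_re_latticeKernel`; the leg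
   dictionary `legIdx` (field leg `inl κ` at `x` ↦ box index `inl (κ, proj N x)`; multiplier leg `inr κ` ↦ `inr (inr κ)`), `LegOn`
   (multiplier legs live on the coarse sublattice), and **`KInv_eq_re_latticeKernel`**:
   `KInv N x y a b = if LegOn a x ∧ LegOn b y then Re (latticeKernel (fibInv N (legIdx a x) (legIdx b y)) (quo N x − quo N y)) else 0`.
§3 SUP BOUNDS: `abs_re_latticeKernel_le_of_norm_le` (`‖G‖ ≤ ε` on the real zone, integrand integrable ⇒ `|Re latticeKernel G x| ≤ ε`,
   via pv09's `B6QGQFourier275Zd.norm_latticeKernel_le`), and **`abs_KInv_le_of_fibInv_le`**: a real-zone entrywise bound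
   `‖fibInv N i j (ofRealVec p)‖ ≤ ε` gives `|KInv N x y a b| ≤ ε` for the corresponding legs.
WHAT IS NOT HERE: the decimated / unit-normalised family (`KInvStep`, `unitK`: the same unfolding through `OneStepKernelFamily.dec`'s finite
leg sums, next file), any estimate of `fibInv` (inputs (I2)/(I3) of the census), any `j`-uniformity.  NOT BetaPertH, NOT continuum, NOT Clay.
-/

noncomputable section

open Complex MeasureTheory
open Literature.MathematicalPhysics.QuantumFieldTheory
open Literature.MathematicalPhysics.QuantumFieldTheory.Balaban1983to89
open Literature.MathematicalPhysics.QuantumFieldTheory.Balaban1983to89.Beta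
open Literature.Probability.LatticeModels (TorusSite Torus.proj)
open LatticeForm (repZ quo proj_repZ proj_add_zsmul)
open B4Strip (ofRealVec)
open B4ContourShift (latticeKernel BZ integrand)
open BlochFibreUniqueness (quo_add_zsmul quo_repZ)
open BlochFibreMatrix (Idx stencil pieceMatrix fundCfg cfgA cfgφ)
open FibreInverseDecay (invKernel invKernel_apply trigPolySymbol)
open KKTFluctuationKernel (srcEL mulVec_srcEL Gam GamΦ wΓ wΓφ gcolA gcolφ)
open KernelSpecInstance (src mulVec_src wH wΦ colA colφ re1 re1_apply)
open OneStepResolventKernel (Fib KInv)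

namespace Summit.QuantumFields.BalabanUV.Beta.GAN24.CombesThomasFibre

variable {d N : ℕ} [NeZero N]

/-! ## §1 The inverse-fibre entry functions and the columns of the fundamental configuration -/

/-- [folklore] THE INVERSE-FIBRE ENTRY FUNCTION `p ↦ (F_N(p)⁻¹)_{ij}` of the typed KKT block system, on complex momenta
(`F_N(p) = trigPolySymbol (stencil (d+1)) pieceMatrix p`; at real `p` this is `(fibreMatrix (blochChar p))⁻¹ i j`). -/
def fibInv (N : ℕ) [NeZero N] (i j : Idx (d + 1) N) : (Fin (d + 1) → ℂ) → ℂ :=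
  fun p => (trigPolySymbol (stencil (d + 1)) (pieceMatrix (N := N)) p)⁻¹ i j

/-- [folklore] The fundamental configuration with a unit FORCE source reads one column of the inverse kernel. -/
theorem fundCfg_srcEL_apply (l : Fin (d + 1)) (z₀ : TorusSite (d + 1) N) (q : Fin (d + 1) → ℤ) (i : Idx (d + 1) N) :
    fundCfg (srcEL (N := N) l z₀) q i = latticeKernel (fibInv N i (Sum.inl (l, z₀))) q := by
  unfold fundCfg
  rw [mulVec_srcEL, invKernel_apply]
  rfl

/-- [folklore] The fundamental configuration with a unit CONSTRAINT source reads one column of the inverse kernel. -/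
theorem fundCfg_src_apply (l : Fin (d + 1)) (q : Fin (d + 1) → ℤ) (i : Idx (d + 1) N) :
    fundCfg (src (N := N) l) q i = latticeKernel (fibInv N i (Sum.inr (Sum.inr l))) q := by
  unfold fundCfg
  rw [mulVec_src, invKernel_apply]
  rfl

/-! ## §2 The four blocks of the packed resolvent as real parts of lattice kernels -/

/-- [folklore] `quo N (x − N • t) = quo N x − t`. -/
theorem quo_sub_zsmul (x t : Fin (d + 1) → ℤ) : quo N (x - (N : ℤ) • t) = quo N x - t := by
  rw [sub_eq_add_neg, ← smul_neg, quo_add_zsmul, sub_eq_add_neg]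

omit [NeZero N] in
/-- [folklore] `proj N (x − N • t) = proj N x`. -/
theorem proj_sub_zsmul (x t : Fin (d + 1) → ℤ) : Torus.proj N (x - (N : ℤ) • t) = Torus.proj N x := by
  rw [sub_eq_add_neg, ← smul_neg, proj_add_zsmul]

/-- [folklore] **THE FLUCTUATION COVARIANCE BLOCK** `Γ`: `Gam κ x l x' = Re (2π)^{-(d+1)}∫ (F_N(p)⁻¹)_{(κ, proj x),(l, proj x')} e^{ip·(quo x − quo x')} dp`. -/
theorem Gam_eq_re_latticeKernel (κ : Fin (d + 1)) (x : Fin (d + 1) → ℤ) (l : Fin (d + 1)) (x' : Fin (d + 1) → ℤ) :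
    Gam (N := N) κ x l x' =
      (latticeKernel (fibInv N (Sum.inl (κ, Torus.proj N x)) (Sum.inl (l, Torus.proj N x'))) (quo N x - quo N x')).re := by
  unfold Gam wΓ gcolA
  rw [re1_apply]
  unfold cfgA
  rw [fundCfg_srcEL_apply, quo_sub_zsmul, proj_sub_zsmul]

/-- [folklore] **THE MINIMISER BLOCK** `ℋ` (field response to a prescribed block average): `wH κ l z = Re latticeKernel (F⁻¹)_{(κ,proj z),(Q,l)} (quo z)`. -/
theorem wH_eq_re_latticeKernel (κ l : Fin (d + 1)) (z : Fin (d + 1) → ℤ) :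
    wH (N := N) κ l z = (latticeKernel (fibInv N (Sum.inl (κ, Torus.proj N z)) (Sum.inr (Sum.inr l))) (quo N z)).re := by
  unfold wH colA cfgA
  rw [fundCfg_src_apply]

/-- [folklore] **THE MULTIPLIER RESPONSE TO A FORCE** `ℋ♭`: `GamΦ κ q l x' = Re latticeKernel (F⁻¹)_{(Q,κ),(l,proj x')} (q − quo x')`. -/
theorem GamΦ_eq_re_latticeKernel (κ : Fin (d + 1)) (q : Fin (d + 1) → ℤ) (l : Fin (d + 1)) (x' : Fin (d + 1) → ℤ) :
    GamΦ (N := N) κ q l x' =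
      (latticeKernel (fibInv N (Sum.inr (Sum.inr κ)) (Sum.inl (l, Torus.proj N x'))) (q - quo N x')).re := by
  unfold GamΦ wΓφ gcolφ
  rw [re1_apply]
  unfold cfgφ
  rw [fundCfg_srcEL_apply]

/-- [folklore] **THE MULTIPLIER RESPONSE TO A PRESCRIBED AVERAGE**: `wΦ κ l y = Re latticeKernel (F⁻¹)_{(Q,κ),(Q,l)} y`. -/
theorem wΦ_eq_re_latticeKernel (κ l : Fin (d + 1)) (y : Fin (d + 1) → ℤ) :
    wΦ (N := N) κ l y = (latticeKernel (fibInv N (Sum.inr (Sum.inr κ)) (Sum.inr (Sum.inr l))) y).re := by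
  unfold wΦ colφ cfgφ
  rw [fundCfg_src_apply]

/-- [folklore] THE LEG DICTIONARY: the box index of a packed leg — a field leg `inl κ` at the fine point `x` is the box coordinate
`inl (κ, proj N x)`, a multiplier leg `inr κ` is the Q-row / `φ`-column index `inr (inr κ)` (it carries no intra-block coordinate). -/
def legIdx (N : ℕ) [NeZero N] (a : Fib d) (x : Fin (d + 1) → ℤ) : Idx (d + 1) N :=
  match a with
  | Sum.inl κ => Sum.inl (κ, Torus.proj N x)
  | Sum.inr κ => Sum.inr (Sum.inr κ)

/-- [folklore] WHERE A LEG LIVES: field legs everywhere, multiplier legs on the coarse sublattice `N • ℤ^{d+1}` (`proj N x = 0`) —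
the support convention of `OneStepResolventKernel.KInv`.  A decidable predicate over the leg data, never a fact. -/
def LegOn (N : ℕ) [NeZero N] (a : Fib d) (x : Fin (d + 1) → ℤ) : Prop :=
  match a with
  | Sum.inl _ => True
  | Sum.inr _ => Torus.proj N x = 0

/-- [folklore] `LegOn` is decidable (the `if` of `KInv_eq_re_latticeKernel`). -/
instance instDecidableLegOn (a : Fib d) (x : Fin (d + 1) → ℤ) : Decidable (LegOn N a x) := by
  cases a with
  | inl κ => exact isTrue trivial
  | inr κ => unfold LegOn; infer_instance

/-- [folklore] A point of the coarse sublattice is `N •` its block index. -/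
theorem eq_zsmul_quo_of_proj_eq_zero {x : Fin (d + 1) → ℤ} (hx : Torus.proj N x = 0) : x = (N : ℤ) • quo N x := by
  have h := BlochFibreMatrix.eq_repZ_add_zsmul_quo (N := N) x
  rw [hx, BlochFibreMatrix.repZ_zero, zero_add] at h
  exact h

/-- [folklore] **THE PACKED RESOLVENT IS THE REAL PART OF THE LATTICE KERNEL OF THE INVERSE FIBRE MATRIX, ENTRY BY ENTRY**:
for every blocking `N`, all fine points `x, y` and legs `a, b`,
`KInv N x y a b = if LegOn a x ∧ LegOn b y then Re (latticeKernel (fibInv N (legIdx a x) (legIdx b y)) (quo N x − quo N y)) else 0`. -/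
theorem KInv_eq_re_latticeKernel (x y : Fin (d + 1) → ℤ) (a b : Fib d) :
    KInv (N := N) x y a b =
      if LegOn N a x ∧ LegOn N b y then (latticeKernel (fibInv N (legIdx N a x) (legIdx N b y)) (quo N x - quo N y)).re else 0 := by
  cases a with
  | inl κ =>
    cases b with
    | inl l =>
        rw [OneStepResolventKernel.KInv_inl_inl, Gam_eq_re_latticeKernel]
        simp only [LegOn, true_and, if_true]
        rfl
    | inr l =>
        by_cases hy : Torus.proj N y = 0
        · have ey := eq_zsmul_quo_of_proj_eq_zero hy
          simp only [LegOn, hy, true_and, if_true]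
          rw [ey, OneStepResolventKernel.KInv_inl_inr_coarse, wH_eq_re_latticeKernel, quo_sub_zsmul, proj_sub_zsmul,
            OneStepResolventKernel.quo_zsmul]
          rfl
        · rw [OneStepResolventKernel.KInv_inl_inr_off hy]
          simp only [LegOn, hy, and_false, if_false]
  | inr κ =>
    by_cases hx : Torus.proj N x = 0
    · have ex := eq_zsmul_quo_of_proj_eq_zero hx
      cases b with
      | inl l =>
          simp only [LegOn, hx, and_true, if_true]
          rw [ex, OneStepResolventKernel.KInv_inr_inl_coarse, GamΦ_eq_re_latticeKernel, OneStepResolventKernel.quo_zsmul]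
          rfl
      | inr l =>
          by_cases hy : Torus.proj N y = 0
          · have ey := eq_zsmul_quo_of_proj_eq_zero hy
            simp only [LegOn, hx, hy, and_self, if_true]
            rw [ex, ey, OneStepResolventKernel.KInv_inr_inr_coarse, wΦ_eq_re_latticeKernel, OneStepResolventKernel.quo_zsmul,
              OneStepResolventKernel.quo_zsmul]
            rfl
          · simp only [LegOn, hx, hy, and_false, if_false]
            unfold KInv
            simp only [hy, and_false, if_false]
    · rw [OneStepResolventKernel.KInv_inr_off hx]
      simp only [LegOn, hx, false_and, if_false]

/-! ## §3 Sup bounds: a real-zone bound on an inverse-fibre entry bounds the packed resolvent entry -/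

/-- [folklore] `|Re K(x)| ≤ ε` for the lattice kernel of a multiplier bounded by `ε` on the real zone (integrable integrand):
`(2π)^{−D} ∫_{zone} ‖G‖ ≤ ε` (pv09's `B6QGQFourier275Zd.norm_latticeKernel_le`) and `|Re z| ≤ ‖z‖`. -/
theorem abs_re_latticeKernel_le_of_norm_le {D : ℕ} (G : (Fin D → ℂ) → ℂ) (x : Fin D → ℤ) {ε : ℝ}
    (hint : IntegrableOn (fun p => ‖G (ofRealVec p)‖) (BZ D)) (hG : ∀ p ∈ BZ D, ‖G (ofRealVec p)‖ ≤ ε) :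
    |(latticeKernel G x).re| ≤ ε := by
  have hvol : volume (BZ D) < ⊤ := by unfold BZ; exact measure_Icc_lt_top
  have hε : 0 ≤ ε := (norm_nonneg _).trans (hG (fun _ => 0) (by
    refine Set.mem_Icc.2 ⟨fun _ => ?_, fun _ => ?_⟩ <;> simp [Real.pi_pos.le]))
  have hreal : volume.real (BZ D) = (2 * Real.pi) ^ D := by
    rw [measureReal_def, BZ, Real.volume_Icc_pi_toReal]
    · simp only [sub_neg_eq_add, Finset.prod_const, Finset.card_univ, Fintype.card_fin]; ring
    · intro j; simp only; linarith [Real.pi_pos]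
  have h1 : ∫ p in BZ D, ‖G (ofRealVec p)‖ ≤ ε * (2 * Real.pi) ^ D := by
    have h := setIntegral_mono_on hint (integrableOn_const (hs := hvol.ne)) measurableSet_Icc hG
    rwa [setIntegral_const, hreal, smul_eq_mul, mul_comm] at h
  have hpos : (0 : ℝ) < (2 * Real.pi) ^ D := by positivity
  calc |(latticeKernel G x).re| ≤ ‖latticeKernel G x‖ := Complex.abs_re_le_norm _
    _ ≤ ((2 * Real.pi) ^ D)⁻¹ * ∫ p in BZ D, ‖G (ofRealVec p)‖ := B6QGQFourier275Zd.norm_latticeKernel_le G x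
    _ ≤ ((2 * Real.pi) ^ D)⁻¹ * (ε * (2 * Real.pi) ^ D) := mul_le_mul_of_nonneg_left h1 (by positivity)
    _ = ε := by field_simp

/-- [folklore] **A REAL-ZONE ENTRYWISE BOUND ON THE INVERSE FIBRE MATRIX BOUNDS THE PACKED RESOLVENT ENTRY**: if
`‖fibInv N (legIdx a x) (legIdx b y) (ofRealVec p)‖ ≤ ε` for all real `p` in the zone (and that entry function is integrable there —
it is continuous, `FibreInverseDecay`), then `|KInv N x y a b| ≤ ε` (`ε ≥ 0`).  The same with `fibInv N − fibInv N′`-type differences is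
how a fibrewise sup-rate becomes `GAN24/CombesThomas.SupRate` (next file, after decimation and units). -/
theorem abs_KInv_le_of_fibInv_le (x y : Fin (d + 1) → ℤ) (a b : Fib d) {ε : ℝ} (hε : 0 ≤ ε)
    (hint : IntegrableOn (fun p => ‖fibInv N (legIdx N a x) (legIdx N b y) (ofRealVec p)‖) (BZ (d + 1)))
    (hF : ∀ p ∈ BZ (d + 1), ‖fibInv N (legIdx N a x) (legIdx N b y) (ofRealVec p)‖ ≤ ε) :
    |KInv (N := N) x y a b| ≤ ε := by
  rw [KInv_eq_re_latticeKernel]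
  split_ifs with h
  · exact abs_re_latticeKernel_le_of_norm_le _ _ hint hF
  · rw [abs_zero]; exact hε

end Summit.QuantumFields.BalabanUV.Beta.GAN24.CombesThomasFibre

end
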